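import Summits.NavierStokesRegularity.NavierStokesRegularity.Theorems.ApexLocalisation.Negative.BridgeBlowDown

/-!
# `ApexLocalisation` (crux stmt-NavierStokesRegularity-11719): the PICKED line `decaying-ancient-bridge`
# — route-optimality of the bet `stub_hullSelection` — negative-side support (drefute seat, gen 3)

Companion of `Negative/BridgeBlowDown.lean`. All sorry-free, pure logic over the stub statements.

* §0 the remaining stubs as named propositions, VERBATIM after their engine / radiation-bound antecedent
  (`RateToAncientCore`, `HullSelectionCore` = THE BET, `HullClosureCore`; conformance `Iff.rfl` examples
  against the verbatim stub types at the end).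
* §1 `apexLocalisation_of_cores` (the lead's composition over the cores);
  `hullSelectionCore_of_target_of_crux` : under the route target `X = RellichScar.NoApexTypeIProfile` the
  crux makes every 𝒜(C,B) trivial (`ClassGivesRateProfile` + landed `not_rateProfileExists_iff_target_and_crux`),
  so the bet holds vacuously; hence `hullSelectionCore_iff_crux_of_target` : **⇒ transfer, hull closure,
  ⇐ transfer and `ClassGivesRateProfile` granted, under `X` the bet ⇔ the crux**;
  `not_target_of_crux_of_not_hullSelectionCore` : a failure of the bet while the crux holds refutes `X`;
  `hullSelectionCore_iff_trivial_of_target` : under `X` the bet ⇔ "every 𝒜(C,B) is trivial".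
* §3 with the engine (`Negative/BridgeBlowDown.lean` discharges the ⇐ transfer and `ClassGivesRateProfile`):
  **`bet_iff_crux_of_target : SlabEngine → RateToAncientCore → HullClosureCore → X → (HullSelectionCore ↔ crux)`**,
  `bet_iff_trivial_of_target`, `bet_failure_dichotomy : SlabEngine → ¬HullSelectionCore → ApexProfileExists ∨ ¬crux`,
  and the LINE STATUS `apexLocalisation_of_engine_transfer_closure_bet : SlabEngine → RateToAncientCore →
  HullClosureCore → HullSelectionCore → crux`. The hypothesis `HullClosureCore` is itself discharged by the engine in the
  sibling `Negative/BridgeHullClosure.lean` (p75945): `fun hE _ _ _ _ _ _ _ hM hadm hconv hN =>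
  inBridgeClass_hullLimit hE hM hadm hconv hN : SlabEngine → HullClosureCore` (not imported here only because of farm
  build order; a client imports both). So after gen 3 the line `decaying-ancient-bridge` is reduced to its engine
  (`stub_slabCompactness`), its ⇒ transfer (`stub_rateToAncient`) and the bet (`stub_hullSelection`, fed by
  `stub_radiationBound`).

Reading for the lead / planners: the bet is stated in ∀-form over 𝒜(C,B) and is, in the abstract,
STRONGER than the ∃→∃ crux (one localisable and one "daughter-gas" Type-I ancient solution would separate
them) — but every separating world has `¬X`, where the route `RellichScar` is dead anyway. For the route
the bet carries no risk beyond the crux itself; no weakening of `stub_hullSelection` is worth looking for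
on that account (what remains worth weakening is only its PROVABILITY, e.g. feeding it the normalisation
the ⇒ transfer actually produces).

## References

* G. Koch, N. Nadirashvili, G. Seregin, V. Šverák, Acta Math. 203 (2009), §6. [KNSS2009]
* G. Seregin, Lecture notes on regularity theory for the Navier–Stokes equations (2014), Prop. 5.19.
* D. Albritton, T. Barker, J. Math. Fluid Mech. 21 (2019) = arXiv:1811.00502, Thm 1.1. [AlbrittonBarker2019]
-/

set_option linter.dupNamespace false

noncomputable section

open MeasureTheory TopologicalSpace Set Function Filter Topology Metric
open scoped InnerProductSpace RealInnerProductSpace ENNReal NNReal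
open Literature.Analysis Literature.Analysis.FluidPDE
open Summit.NavierStokesRegularity.NavierStokesRegularity.Theses

namespace Summit.NavierStokesRegularity.NavierStokesRegularity.Theorems.ApexLocalisation.Negative

/-- Physical space (the skeleton writes `E³`). -/
local notation "E³" => EuclideanSpace ℝ (Fin 3)

/-! ## §0 The ⇒ transfer, the bet and the hull closure as named propositions (verbatim) -/

/-- The consequent of `stub_rateToAncient` (⇒ TRANSFER) after the engine is fed, verbatim
(antecedent = `∃ u p G, IsRateProfile C u p G`, conclusion over `InBridgeClass` — both by `Iff.rfl`). -/
def RateToAncientCore : Prop :=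
  ∀ C : ℝ,
      (∃ (u : ℝ → E³ → E³) (p : ℝ → E³ → ℝ) (G : ℝ → E³ → E³ →L[ℝ] E³),
        IsSuitableWeakSolutionOn (slab E³ (Iio 0) isOpen_Iio) 1 0 u p ∧
        HasWeakSpatialGradientOn (slab E³ (Iio 0) isOpen_Iio) u G ∧
        typeIBound (Iio (0 : ℝ) ×ˢ univ) u p G < ⊤ ∧ HasTypeITimeDecay C u ∧
        IsBackwardSingularPoint u 0) →
      ∃ (B : ℝ) (M : ℝ → E³ → E³), InBridgeClass C B M ∧ (∃ s : ℝ, s < 0 ∧ ∃ y : E³, M s y ≠ 0)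

/-- The consequent of `stub_hullSelection` (THE BET) after the radiation bound is fed, verbatim. -/
def HullSelectionCore : Prop :=
  ∀ (C B : ℝ) (M : ℝ → E³ → E³), InBridgeClass C B M →
      (∃ s : ℝ, s < 0 ∧ ∃ y : E³, M s y ≠ 0) →
      ∃ (xk : ℕ → E³) (tk : ℕ → ℝ) (lk : ℕ → ℝ) (N : ℝ → E³ → E³),
        (∀ k, tk k ≤ 0 ∧ 0 < lk k ∧ lk k ≤ 1) ∧
        (∀ t < 0, TendstoLocallyUniformly
          (fun k (y : E³) => lk k • M (tk k + lk k ^ 2 * t) (xk k + lk k • y)) (N t) atTop) ∧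
        ContinuousOn (uncurry N) (Iio (0 : ℝ) ×ˢ univ) ∧
        (∃ s : ℝ, s < 0 ∧ ∃ y : E³, N s y ≠ 0) ∧
        ∃ K : ℝ, ∀ s < 0, ∀ y : E³, ‖y‖ * ‖N s y‖ ≤ K

/-- The consequent of `stub_hullClosed` (HULL CLOSURE) after the engine is fed, verbatim. -/
def HullClosureCore : Prop :=
  ∀ (C B : ℝ) (M : ℝ → E³ → E³) (xk : ℕ → E³) (tk : ℕ → ℝ) (lk : ℕ → ℝ) (N : ℝ → E³ → E³),
      InBridgeClass C B M →
      (∀ k, tk k ≤ 0 ∧ 0 < lk k ∧ lk k ≤ 1) →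
      (∀ t < 0, TendstoLocallyUniformly
        (fun k (y : E³) => lk k • M (tk k + lk k ^ 2 * t) (xk k + lk k • y)) (N t) atTop) →
      ContinuousOn (uncurry N) (Iio (0 : ℝ) ×ˢ univ) →
      InBridgeClass C B N

/-! ## §1 Route-optimality of the bet (pure logic over the named propositions) -/

/-- Glue (the lead's `shiftedDecay_of_bounds`, verbatim): `‖N‖ ≤ B`, the rate `C` and
`‖y‖‖N‖ ≤ K` give the shifted decay `(B + C + K)/(1 + ‖y‖ + √(−t))`. -/
theorem shiftedDecay_of_bounds' {N : ℝ → E³ → E³} {B C K : ℝ}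
    (hB : ∀ t < 0, ∀ x : E³, ‖N t x‖ ≤ B) (hC : HasTypeITimeDecay C N)
    (hK : ∀ s < 0, ∀ y : E³, ‖y‖ * ‖N s y‖ ≤ K) :
    ∀ t : ℝ, t < 0 → ∀ x : E³, ‖N t x‖ ≤ (B + C + K) / (1 + ‖x‖ + Real.sqrt (-t)) := by
  intro t ht x
  have hs : 0 < Real.sqrt (-t) := Real.sqrt_pos.2 (by linarith)
  have hden : 0 < 1 + ‖x‖ + Real.sqrt (-t) := by positivity
  rw [le_div_iff₀ hden]
  have h1 := hB t ht x
  have h2 : Real.sqrt (-t) * ‖N t x‖ ≤ C := by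
    have := hC t ht x
    rwa [le_div_iff₀ hs, mul_comm] at this
  have h3 := hK t ht x
  nlinarith [norm_nonneg (N t x), norm_nonneg x]

/-- **The composition with the cores** (= the lead's `ApexLocalisation_of`, engine and radiation bound
already fed): ⇒ transfer, the bet, hull closure and ⇐ transfer imply the crux. -/
theorem apexLocalisation_of_cores (h1 : RateToAncientCore) (h3 : HullSelectionCore)
    (h4 : HullClosureCore) (h5 : ApexOfDecayingCore) : RellichScar.ApexLocalisation := by
  intro C hRate
  obtain ⟨B, M, hM, hMnt⟩ := h1 C hRate
  obtain ⟨xk, tk, lk, N, hadm, hconv, hNcont, hNnt, K, hK⟩ := h3 C B M hM hMnt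
  obtain ⟨-, -, -, hNB, hNC, q, H, hsws, hgrad, hI⟩ := h4 C B M xk tk lk N hM hadm hconv hNcont
  have hdecay := shiftedDecay_of_bounds' hNB hNC hK
  obtain ⟨s, hs, y, hy⟩ := hNnt
  have hnt := not_ae_eq_zero_of_continuousOn_slab hNcont hs hy
  exact h5 ⟨B + C + K, N, q, H, hsws, hgrad, hI, hnt, hdecay⟩

/-- **Under the route target, the crux makes 𝒜(C,B) trivial**: `X ∧ crux ⇒ ¬RateProfileExists`
(landed `not_rateProfileExists_iff_target_and_crux`), and by `ClassGivesRateProfile` every member of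
every 𝒜(C,B) then vanishes on the slab. -/
theorem inBridgeClass_trivial_of_target_of_crux (hG : ClassGivesRateProfile)
    (hX : RellichScar.NoApexTypeIProfile) (hcrux : RellichScar.ApexLocalisation)
    {C B : ℝ} {M : ℝ → E³ → E³} (hM : InBridgeClass C B M) : ∀ s < 0, ∀ y : E³, M s y = 0 := by
  have hno : ¬ RateProfileExists := not_rateProfileExists_iff_target_and_crux.2 ⟨hX, hcrux⟩
  intro s hs y
  by_contra hy
  exact hno (hG C B M hM ⟨s, hs, y, hy⟩)

/-- **Under the route target, the crux implies the bet** (vacuously: there is nothing to select from). -/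
theorem hullSelectionCore_of_target_of_crux (hG : ClassGivesRateProfile)
    (hX : RellichScar.NoApexTypeIProfile) (hcrux : RellichScar.ApexLocalisation) :
    HullSelectionCore := by
  intro C B M hM hMnt
  obtain ⟨s, hs, y, hy⟩ := hMnt
  exact absurd (inBridgeClass_trivial_of_target_of_crux hG hX hcrux hM s hs y) hy

/-- **ROUTE-OPTIMALITY OF THE BET.** Granted the line's known stubs (⇒ transfer, hull closure,
⇐ transfer — engine fed) and `ClassGivesRateProfile`, UNDER THE ROUTE TARGET `X` the bet is
EQUIVALENT to the crux. -/
theorem hullSelectionCore_iff_crux_of_target (h1 : RateToAncientCore) (h4 : HullClosureCore)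
    (h5 : ApexOfDecayingCore) (hG : ClassGivesRateProfile) (hX : RellichScar.NoApexTypeIProfile) :
    HullSelectionCore ↔ RellichScar.ApexLocalisation :=
  ⟨fun h3 => apexLocalisation_of_cores h1 h3 h4 h5, hullSelectionCore_of_target_of_crux hG hX⟩

/-- **Where the bet can fail while the crux holds: only off the route.** If the bet is false but the
crux is true then the route target `X` is false (an apex profile exists) — i.e. the route `RellichScar`
is dead in every such world. -/
theorem not_target_of_crux_of_not_hullSelectionCore (hG : ClassGivesRateProfile)
    (h3 : ¬ HullSelectionCore) (hcrux : RellichScar.ApexLocalisation) :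
    ¬ RellichScar.NoApexTypeIProfile :=
  fun hX => h3 (hullSelectionCore_of_target_of_crux hG hX hcrux)

/-- The same, positively: a failure of the bet exhibits an apex profile or kills the crux. -/
theorem apexProfileExists_or_not_crux_of_not_hullSelectionCore (hG : ClassGivesRateProfile)
    (h3 : ¬ HullSelectionCore) : ApexProfileExists ∨ ¬ RellichScar.ApexLocalisation := by
  by_cases hcrux : RellichScar.ApexLocalisation
  · left
    have := not_target_of_crux_of_not_hullSelectionCore hG h3 hcrux
    rwa [noApexTypeIProfile_iff, not_not] at this
  · exact Or.inr hcrux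

/-- Under the target, the bet is also equivalent to "𝒜 is trivial" (every member of every 𝒜(C,B)
vanishes on the slab), granted hull closure and the ⇐ transfer only. -/
theorem hullSelectionCore_iff_trivial_of_target (h4 : HullClosureCore) (h5 : ApexOfDecayingCore)
    (hX : RellichScar.NoApexTypeIProfile) :
    HullSelectionCore ↔
      ∀ (C B : ℝ) (M : ℝ → E³ → E³), InBridgeClass C B M → ∀ s < 0, ∀ y : E³, M s y = 0 := by
  constructor
  · intro h3 C B M hM s hs y
    by_contra hy
    obtain ⟨xk, tk, lk, N, hadm, hconv, hNcont, hNnt, K, hK⟩ := h3 C B M hM ⟨s, hs, y, hy⟩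
    obtain ⟨-, -, -, hNB, hNC, q, H, hsws, hgrad, hI⟩ := h4 C B M xk tk lk N hM hadm hconv hNcont
    have hdecay := shiftedDecay_of_bounds' hNB hNC hK
    obtain ⟨s', hs', y', hy'⟩ := hNnt
    have hnt := not_ae_eq_zero_of_continuousOn_slab hNcont hs' hy'
    obtain ⟨C', u, p, G, h⟩ := h5 ⟨B + C + K, N, q, H, hsws, hgrad, hI, hnt, hdecay⟩
    exact (noApexTypeIProfile_iff.1 hX) ⟨C', u, p, G, h⟩
  · intro htriv C B M hM hMnt
    obtain ⟨s, hs, y, hy⟩ := hMnt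
    exact absurd (htriv C B M hM s hs y) hy

/-! ## §3 Packaging: the bet versus the crux, engine granted -/

/-- **LINE STATUS after gen 3**: engine + ⇒ transfer + hull closure + the bet ⇒ the crux (the ⇐ transfer is
discharged modulo the engine; the hull closure is `SlabEngine → HullClosureCore` in `Negative/BridgeHullClosure.lean`). -/
theorem apexLocalisation_of_engine_transfer_closure_bet (hE : SlabEngine) (h1 : RateToAncientCore)
    (h4 : HullClosureCore) (h3 : HullSelectionCore) : RellichScar.ApexLocalisation :=
  apexLocalisation_of_cores h1 h3 h4 (apexOfDecayingCore_of_slabEngine hE)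

/-- **Engine, ⇒ transfer and hull closure granted, under the route target the bet ⇔ the crux.** -/
theorem bet_iff_crux_of_target (hE : SlabEngine) (h1 : RateToAncientCore) (h4 : HullClosureCore)
    (hX : RellichScar.NoApexTypeIProfile) : HullSelectionCore ↔ RellichScar.ApexLocalisation :=
  hullSelectionCore_iff_crux_of_target h1 h4 (apexOfDecayingCore_of_slabEngine hE)
    (classGivesRateProfile_of_slabEngine hE) hX

/-- **Engine and hull closure granted, under the route target the bet ⇔ "every 𝒜(C,B) is trivial".** -/
theorem bet_iff_trivial_of_target (hE : SlabEngine) (h4 : HullClosureCore) (hX : RellichScar.NoApexTypeIProfile) :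
    HullSelectionCore ↔
      ∀ (C B : ℝ) (M : ℝ → E³ → E³), InBridgeClass C B M → ∀ s < 0, ∀ y : E³, M s y = 0 :=
  hullSelectionCore_iff_trivial_of_target h4 (apexOfDecayingCore_of_slabEngine hE) hX

/-- **Engine granted, a failure of the bet either exhibits an apex profile (route dead) or kills the
crux** (no hull closure needed). -/
theorem bet_failure_dichotomy (hE : SlabEngine) (h3 : ¬ HullSelectionCore) :
    ApexProfileExists ∨ ¬ RellichScar.ApexLocalisation :=
  apexProfileExists_or_not_crux_of_not_hullSelectionCore (classGivesRateProfile_of_slabEngine hE) h3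

/-! ### Conformance with the skeleton (textual; the `Lines/` module is not importable) -/

/-- Conformance: the full type of `stub_rateToAncient`, verbatim, is `SlabEngine → RateToAncientCore`. -/
example :
    ((∀ (I : ℝ≥0∞) (v : ℕ → ℝ → E³ → E³) (q : ℕ → ℝ → E³ → ℝ) (G : ℕ → ℝ → E³ → E³ →L[ℝ] E³),
      I < ⊤ →
      (∀ k, IsSuitableWeakSolutionOn (slab E³ (Iio 0) isOpen_Iio) 1 0 (v k) (q k)) →
      (∀ k, HasWeakSpatialGradientOn (slab E³ (Iio 0) isOpen_Iio) (v k) (G k)) →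
      (∀ k, typeIBound (Iio (0 : ℝ) ×ˢ univ) (v k) (q k) (G k) ≤ I) →
      ∃ (u : ℝ → E³ → E³) (p : ℝ → E³ → ℝ) (H : ℝ → E³ → E³ →L[ℝ] E³) (σ : ℕ → ℕ),
        StrictMono σ ∧
        IsSuitableWeakSolutionOn (slab E³ (Iio 0) isOpen_Iio) 1 0 u p ∧
        HasWeakSpatialGradientOn (slab E³ (Iio 0) isOpen_Iio) u H ∧
        typeIBound (Iio (0 : ℝ) ×ˢ univ) u p H ≤ 4 * I ∧
        (∀ R : ℝ, 0 < R → Tendsto (fun j => eLpNorm (uncurry (v (σ j)) - uncurry u) 3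
          (volume.restrict (parabolicCylinder R (0 : ℝ × E³)))) atTop (𝓝 0)) ∧
        ((∀ R : ℝ, 0 < R → limsup (fun j => eLpNorm (uncurry (v (σ j))) ⊤
            (volume.restrict (parabolicCylinder R (0 : ℝ × E³)))) atTop = ⊤) →
          IsBackwardSingularPoint u 0)) →
    ∀ C : ℝ,
      (∃ (u : ℝ → E³ → E³) (p : ℝ → E³ → ℝ) (G : ℝ → E³ → E³ →L[ℝ] E³),
        IsSuitableWeakSolutionOn (slab E³ (Iio 0) isOpen_Iio) 1 0 u p ∧
        HasWeakSpatialGradientOn (slab E³ (Iio 0) isOpen_Iio) u G ∧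
        typeIBound (Iio (0 : ℝ) ×ˢ univ) u p G < ⊤ ∧ HasTypeITimeDecay C u ∧
        IsBackwardSingularPoint u 0) →
      ∃ (B : ℝ) (M : ℝ → E³ → E³),
        (ContinuousOn (uncurry M) (Iio (0 : ℝ) ×ˢ univ) ∧
          (∀ t < 0, IsWeaklyDivFree (M t)) ∧
          (∀ s t : ℝ, s < t → t < 0 → ∀ x : E³,
            M t x = UnboundedOperators.heatExtension (M s) (t - s) x - oseenDuhamel 1 s M M t x) ∧
          (∀ t < 0, ∀ x : E³, ‖M t x‖ ≤ B) ∧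
          HasTypeITimeDecay C M ∧
          (∃ (q : ℝ → E³ → ℝ) (H : ℝ → E³ → E³ →L[ℝ] E³),
            IsSuitableWeakSolutionOn (slab E³ (Iio 0) isOpen_Iio) 1 0 M q ∧
            HasWeakSpatialGradientOn (slab E³ (Iio 0) isOpen_Iio) M H ∧
            typeIBound (Iio (0 : ℝ) ×ˢ univ) M q H < ⊤)) ∧
        (∃ s : ℝ, s < 0 ∧ ∃ y : E³, M s y ≠ 0)) ↔
    (SlabEngine → RateToAncientCore) :=
  Iff.rfl

/-- Conformance: the full type of `stub_hullSelection`, verbatim, is "radiation bound → `HullSelectionCore`". -/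
example :
    ((∃ c₀ : ℝ, ∀ (I B : ℝ) (M : ℝ → E³ → E³), 0 ≤ I →
      ContinuousOn (uncurry M) (Iio (0 : ℝ) ×ˢ univ) →
      (∀ t < 0, ∀ x : E³, ‖M t x‖ ≤ B) →
      (∀ τ < 0, ∀ (z : E³) (r : ℝ), 0 < r → ∫ y in ball z r, ‖M τ y‖ ^ 2 ≤ I * r) →
      ∀ (s t : ℝ), s < t → t < 0 → ∀ x : E³, x ≠ 0 →
        ‖∫ τ in Ioo s t, ∫ y in {y : E³ | ‖x‖ / 2 ≤ ‖y - x‖},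
            oseenKernel (t - τ) (x - y) (M τ y) (M τ y)‖ ≤ c₀ * I / ‖x‖) →
    ∀ (C B : ℝ) (M : ℝ → E³ → E³),
      (ContinuousOn (uncurry M) (Iio (0 : ℝ) ×ˢ univ) ∧
        (∀ t < 0, IsWeaklyDivFree (M t)) ∧
        (∀ s t : ℝ, s < t → t < 0 → ∀ x : E³,
          M t x = UnboundedOperators.heatExtension (M s) (t - s) x - oseenDuhamel 1 s M M t x) ∧
        (∀ t < 0, ∀ x : E³, ‖M t x‖ ≤ B) ∧
        HasTypeITimeDecay C M ∧
        (∃ (q : ℝ → E³ → ℝ) (H : ℝ → E³ → E³ →L[ℝ] E³),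
          IsSuitableWeakSolutionOn (slab E³ (Iio 0) isOpen_Iio) 1 0 M q ∧
          HasWeakSpatialGradientOn (slab E³ (Iio 0) isOpen_Iio) M H ∧
          typeIBound (Iio (0 : ℝ) ×ˢ univ) M q H < ⊤)) →
      (∃ s : ℝ, s < 0 ∧ ∃ y : E³, M s y ≠ 0) →
      ∃ (xk : ℕ → E³) (tk : ℕ → ℝ) (lk : ℕ → ℝ) (N : ℝ → E³ → E³),
        (∀ k, tk k ≤ 0 ∧ 0 < lk k ∧ lk k ≤ 1) ∧
        (∀ t < 0, TendstoLocallyUniformly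
          (fun k (y : E³) => lk k • M (tk k + lk k ^ 2 * t) (xk k + lk k • y)) (N t) atTop) ∧
        ContinuousOn (uncurry N) (Iio (0 : ℝ) ×ˢ univ) ∧
        (∃ s : ℝ, s < 0 ∧ ∃ y : E³, N s y ≠ 0) ∧
        ∃ K : ℝ, ∀ s < 0, ∀ y : E³, ‖y‖ * ‖N s y‖ ≤ K) ↔
    ((∃ c₀ : ℝ, ∀ (I B : ℝ) (M : ℝ → E³ → E³), 0 ≤ I →
      ContinuousOn (uncurry M) (Iio (0 : ℝ) ×ˢ univ) →
      (∀ t < 0, ∀ x : E³, ‖M t x‖ ≤ B) →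
      (∀ τ < 0, ∀ (z : E³) (r : ℝ), 0 < r → ∫ y in ball z r, ‖M τ y‖ ^ 2 ≤ I * r) →
      ∀ (s t : ℝ), s < t → t < 0 → ∀ x : E³, x ≠ 0 →
        ‖∫ τ in Ioo s t, ∫ y in {y : E³ | ‖x‖ / 2 ≤ ‖y - x‖},
            oseenKernel (t - τ) (x - y) (M τ y) (M τ y)‖ ≤ c₀ * I / ‖x‖) → HullSelectionCore) :=
  Iff.rfl

/-- Conformance: the full type of `stub_hullClosed`, verbatim, is `SlabEngine → HullClosureCore`. -/
example :
    ((∀ (I : ℝ≥0∞) (v : ℕ → ℝ → E³ → E³) (q : ℕ → ℝ → E³ → ℝ) (G : ℕ → ℝ → E³ → E³ →L[ℝ] E³),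
      I < ⊤ →
      (∀ k, IsSuitableWeakSolutionOn (slab E³ (Iio 0) isOpen_Iio) 1 0 (v k) (q k)) →
      (∀ k, HasWeakSpatialGradientOn (slab E³ (Iio 0) isOpen_Iio) (v k) (G k)) →
      (∀ k, typeIBound (Iio (0 : ℝ) ×ˢ univ) (v k) (q k) (G k) ≤ I) →
      ∃ (u : ℝ → E³ → E³) (p : ℝ → E³ → ℝ) (H : ℝ → E³ → E³ →L[ℝ] E³) (σ : ℕ → ℕ),
        StrictMono σ ∧
        IsSuitableWeakSolutionOn (slab E³ (Iio 0) isOpen_Iio) 1 0 u p ∧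
        HasWeakSpatialGradientOn (slab E³ (Iio 0) isOpen_Iio) u H ∧
        typeIBound (Iio (0 : ℝ) ×ˢ univ) u p H ≤ 4 * I ∧
        (∀ R : ℝ, 0 < R → Tendsto (fun j => eLpNorm (uncurry (v (σ j)) - uncurry u) 3
          (volume.restrict (parabolicCylinder R (0 : ℝ × E³)))) atTop (𝓝 0)) ∧
        ((∀ R : ℝ, 0 < R → limsup (fun j => eLpNorm (uncurry (v (σ j))) ⊤
            (volume.restrict (parabolicCylinder R (0 : ℝ × E³)))) atTop = ⊤) →
          IsBackwardSingularPoint u 0)) →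
    ∀ (C B : ℝ) (M : ℝ → E³ → E³) (xk : ℕ → E³) (tk : ℕ → ℝ) (lk : ℕ → ℝ) (N : ℝ → E³ → E³),
      (ContinuousOn (uncurry M) (Iio (0 : ℝ) ×ˢ univ) ∧
        (∀ t < 0, IsWeaklyDivFree (M t)) ∧
        (∀ s t : ℝ, s < t → t < 0 → ∀ x : E³,
          M t x = UnboundedOperators.heatExtension (M s) (t - s) x - oseenDuhamel 1 s M M t x) ∧
        (∀ t < 0, ∀ x : E³, ‖M t x‖ ≤ B) ∧
        HasTypeITimeDecay C M ∧
        (∃ (q : ℝ → E³ → ℝ) (H : ℝ → E³ → E³ →L[ℝ] E³),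
          IsSuitableWeakSolutionOn (slab E³ (Iio 0) isOpen_Iio) 1 0 M q ∧
          HasWeakSpatialGradientOn (slab E³ (Iio 0) isOpen_Iio) M H ∧
          typeIBound (Iio (0 : ℝ) ×ˢ univ) M q H < ⊤)) →
      (∀ k, tk k ≤ 0 ∧ 0 < lk k ∧ lk k ≤ 1) →
      (∀ t < 0, TendstoLocallyUniformly
        (fun k (y : E³) => lk k • M (tk k + lk k ^ 2 * t) (xk k + lk k • y)) (N t) atTop) →
      ContinuousOn (uncurry N) (Iio (0 : ℝ) ×ˢ univ) →
      (ContinuousOn (uncurry N) (Iio (0 : ℝ) ×ˢ univ) ∧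
        (∀ t < 0, IsWeaklyDivFree (N t)) ∧
        (∀ s t : ℝ, s < t → t < 0 → ∀ x : E³,
          N t x = UnboundedOperators.heatExtension (N s) (t - s) x - oseenDuhamel 1 s N N t x) ∧
        (∀ t < 0, ∀ x : E³, ‖N t x‖ ≤ B) ∧
        HasTypeITimeDecay C N ∧
        (∃ (q : ℝ → E³ → ℝ) (H : ℝ → E³ → E³ →L[ℝ] E³),
          IsSuitableWeakSolutionOn (slab E³ (Iio 0) isOpen_Iio) 1 0 N q ∧
          HasWeakSpatialGradientOn (slab E³ (Iio 0) isOpen_Iio) N H ∧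
          typeIBound (Iio (0 : ℝ) ×ˢ univ) N q H < ⊤))) ↔
    (SlabEngine → HullClosureCore) :=
  Iff.rfl

end Summit.NavierStokesRegularity.NavierStokesRegularity.Theorems.ApexLocalisation.Negative
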